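import Summits.FinalStateConjecture.FinalStateConjecture.Theses.PhaseMixingCapture
import Literature.Geometry.Lorentzian.KerrFrequencyRanges
import Literature.Geometry.Lorentzian.KerrTortoiseRadius
import Literature.Geometry.Lorentzian.TeukolskyWronskianBound
import HarnessLib.Audit

/-!
# Line `bf-sign-frozen-ranges` — crux `KappaExplicitWaveDecay` (stmt-FinalStateConjecture-10654),
# route `PhaseMixingCapture`

CRUX-PLAN skeleton (planner `cruxplan-stmt-FinalStateConjecture-10654-bf-sign-frozen-range`, round 1).
Idea card `bf-sign-frozen-ranges` (merged by triage r1-1 with `hardy-is-bf-sector-split`): run the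
Dafermos–Rodnianski–Shlapentokh-Rothman (DRSR, arXiv:1402.7034) frequency analysis on the WHOLE
sub-extremal range `0 ≤ a < M` with the `a`-dependent partition of their §8.1 replaced, inside the
near-superradiant strip, by the `a`-INDEPENDENT partition of the Carter sectors by the sign of
`Λ − (2 ± θ)m²` — the Breitenlohner–Freedman discriminant of the near-horizon (near-NHEK) throat
(at `a = M`, `ω = ω₊m`: `V₀ − ω² = (r−M)²[4M²Λ − m²(r²+2Mr+5M²)]/(4M²(r²+M²)²)`, whose bracket at
`r = M` is `4M²(Λ − 2m²)`):

* BF-STABLE sectors `Λ ≥ (2+θ)m²` keep DRSR's "superradiant ⇒ quantitatively not trapped" with a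
  margin `b(θ)Λ/M²` UNIFORM in `a` (`stub_frozenStableBarrier`, the card's first lemma), so DRSR's
  Prop. 8.3.1 runs verbatim there (`stub_stableStripEstimate`);
* THROAT sectors `Λ ≤ (2−θ)m²` (`|m| ≥ 2`) lose the barrier exactly as DRSR p. 7 says ("at the
  endpoint of the superradiant frequency range one loses the ε"): its height is `≍ (1−a²/M²)Λ`, at
  `r_max − r₊ ≍ r₊ − r₋`, inside a cavity of tortoise length `≍ κ⁻¹` carrying the in-throat
  trapping — the new, `κ`-polynomial multiplier estimate is `stub_throatStripEstimate` (HARDEST);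
* the BF-critical SLIVER `|Λ − 2m²| < θm²` (degenerate near-horizon critical point) is its own
  clause, needed only for SOME `θ > 0` (`stub_sliverStripEstimate`);
* everything DRSR already does `a`-uniformly — the four non-sharp ranges `𝓖_♯, 𝓖_𝄬, 𝓖_♮, 𝓖_♭` off the
  frozen strip and all bounded frequencies — is `stub_offStripEstimate`;
* the bounded-frequency horizon amplitude `|u(−∞)|²` is controlled `a`-uniformly by Teixeira da
  Costa's Prop. 6.3 (arXiv:1910.02854), vendored UNPROVED as
  `Kerr.Costa2019_wronskianBound_subextremal` — surfaced by name as `stub_boundedFrequencyWronskian`;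
* the physical-space packaging (Carter separation + Plancherel, DRSR §§4, 9–11 with `κ`-explicit
  red-shift constants, reduction to `a ≥ 0`, and the Kerr–Schild slice bookkeeping of
  `KerrWaveEnergy.lean` / `KerrIntegratedDecay.lean`) is `stub_physicalSpaceTransfer`.

The four range stubs conclude ONE common `κ̂`-explicit form of the conclusion of DRSR Theorem 8.1
(`FrozenEstimateAt`, `FrozenThm81On`; `κ̂ = 1 − (a/M)² ≍ (κM)²`; multipliers bounded by the
frequency-independent `B = C·κ̂^{-p}·(M/δ₀)^p·(R_b/M)^p·(1+E)^p`, left-hand constant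
`b = [B(1+M²ω²+Λ)^p]⁻¹`, i.e. polynomial losses in `κ⁻¹`, in the distance `δ₀` of the bulk region to
the horizon, and finitely many derivatives); the composition
`KappaExplicitWaveDecay_of` is DRSR's Lemma 8.1.1 for the frozen partition (the ranges cover all
admissible triples) followed by the transfer. Disproof.lean: none published for this crux at planning
time (`ledger crux ls`, 2026-08-16); `ledger negatives --problem FinalStateConjecture`: 0.
-/

noncomputable section

namespace Summit.FinalStateConjecture.FinalStateConjecture.Cruxes.KappaExplicitWaveDecay.BfSignFrozenRanges

open scoped InnerProductSpace ComplexConjugate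
open Filter Topology MeasureTheory Set
open Literature.Geometry.Lorentzian Literature.Geometry.Lorentzian.Kerr

/-! ## Common vocabulary: the `κ̂`-explicit conclusion of DRSR Theorem 8.1 for one frequency triple -/

/-- The extremality parameter of the crux, `κ̂ = 1 − (a/M)²` (`(κM)² ≍ κ̂`,
`Kerr.mul_surfaceGravity_mem_Icc`); `KappaExplicitWaveDecay` allows losses `κ̂^{-p}`. -/
def kHat (M a : ℝ) : ℝ := 1 - (a / M) ^ 2

/-- The frequency-INDEPENDENT constant budget of the line: `C · κ̂^{-p} · (M/δ₀)^p · (R_b/M)^p ·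
(1+E)^p` — polynomial in the inverse surface gravity, in the inverse distance `δ₀` of the bulk region
to the horizon (the red-shift layer has width `∝ κ`), in the outer radius `R_b` and in the
energy-current weight `E`. It bounds every multiplier, the far tail, `r_trap` and the box
coefficient (DRSR's uniform `B`). -/
def frozenBound (M a δ₀ Rb E C p : ℝ) : ℝ :=
  C * kHat M a ^ (-p) * (M / δ₀) ^ p * (Rb / M) ^ p * (1 + E) ^ p

/-- The frequency-DEPENDENT left-hand constant `b = [B · (1 + M²ω² + Λ)^p]⁻¹`: polynomial
high-frequency losses (= finitely many `T`, `Φ`, Carter derivatives of the data, the `j` of the crux)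
are allowed on the left-hand side only, as at DRSR's trapping. -/
def frozenLHS (M B p ω Λ : ℝ) : ℝ :=
  (B * (1 + M ^ 2 * ω ^ 2 + Λ) ^ p)⁻¹

/-- The bounded-frequency box `{C⁻¹ ≤ M|ω| ≤ C, Λ ≤ C}` on which (and only on which) the horizon
amplitude `|u(−∞)|²` may appear on the right-hand side (DRSR Thm 8.1's indicator
`1_{ω_low ≤ |ω| ≤ ω_high, Λ ≤ ε⁻¹ω²_high}`; it is then paid for by quantitative mode stability,
here Teixeira da Costa's `a`-uniform Prop. 6.3). -/
def boxIndicator (M C ω Λ : ℝ) : ℝ := by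
  classical
  exact if C⁻¹ ≤ M * |ω| ∧ M * |ω| ≤ C ∧ Λ ≤ C then 1 else 0

/-- The right-hand side source functional `H·(f,h,y,χ)·(u,u')` of DRSR Theorem 8.1, in the sign
conventions of the tree's current identities (`KerrSeparatedCurrents.lean`, §7): from
`Q = Q^f + Ϙ^h + ϟ^y − (e₁ Q^K + e₂ Q^T)` one gets the source
`−2(f+y)·Re(H̄u') − (f' + h)·Re(H̄u) + (e₁ϖ + e₂ω)·Im(Hū)`, `ϖ = ω − ω₊m`. The weights `e₁, e₂`
play DRSR's `Eχ₁, Eχ₂`; all signs of the weights are free (they are existentially quantified). -/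
def frozenSource (ω ϖ : ℝ) (f f₁ h y e₁ e₂ : ℝ → ℝ) (u u₁ H : ℝ → ℂ) (x : ℝ) : ℝ :=
  -(2 * (f x + y x) * ⟪H x, u₁ x⟫_ℝ) - (f₁ x + h x) * ⟪H x, u x⟫_ℝ +
    (e₁ x * ϖ + e₂ x * ω) * (H x * conj (u x)).im

/-- **The conclusion of DRSR Theorem 8.1 for ONE admissible triple `(ω, m, Λ)` on `g_{M,a}`, with
explicit constants.** Data: a tortoise radius function `R = r ∘ (r*)⁻¹` (`Kerr.IsTortoiseRadius`), the
inner radius `r₊ + δ₀` and outer radius `R_b` of the bulk region (DRSR's `[R₋, R₊]`), the far-field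
energy weight `E`, ONE constant `B` bounding every multiplier and `b = B⁻¹`, and the horizon
coefficient `γ` (`= B` on the bounded box, `0` off it). Content, verbatim the shape of DRSR (28)–(29):
there are continuous weights `f, f' = f₁, h, y, e₁, e₂` and a value `r_trap` (`= 0` or in
`[r₊ + B⁻¹, B]`) with `|weights| ≤ B` and the FREQUENCY-INDEPENDENT far structure beyond `r = R_b`
(`f' = h = e₁ = 0`, `e₂ = E`, `|f + y − 1| ≤ B e^{−(r* − R_b*)/B}` — DRSR's "`f + y = 1`, `ỹ`
exponentially decaying", needed to resum the cut-off errors in physical space, their §9.6), such that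
every smooth solution of `u'' + (ω² − V)u = H` (`V = Kerr.sepPotential`, `' = d/dr*`) with the
outgoing boundary conditions (eq:b±) (`u' − iωu → 0` at `+∞`, `u' + iϖu → 0` at `−∞`, `|u|²`
convergent at both ends, exactly as in `Kerr.timeDominated_estimate_kerr`) satisfies
`b ∫_{x₁}^{x₂} [|u'|² + ((ω² + Λ)(1 − r_trap/r)² + 1)|u|²] ≤ ∫ H·(f,h,y,χ)·(u,u') + γ·|u(−∞)|²`
for every `r*`-interval `[x₁, x₂]` with `R(x₁) ≥ r₊ + δ₀`, `R(x₂) ≤ R_b`.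
[cite: DafermosRodnianskiShlapentokhrothman2014, Theorem 8.1 (shape of the conclusion, (28)–(29))] -/
def FrozenEstimateAt (M a δ₀ Rb E B b γ : ℝ) (R : ℝ → ℝ) (ω : ℝ) (m : ℤ) (Λ : ℝ) : Prop :=
  ∃ (f f₁ h y e₁ e₂ : ℝ → ℝ) (rtrap xb : ℝ),
    R xb = Rb ∧
    (rtrap = 0 ∨ (rPlus M a + B⁻¹ ≤ rtrap ∧ rtrap ≤ B)) ∧
    Continuous f ∧ Continuous f₁ ∧ Continuous h ∧ Continuous y ∧ Continuous e₁ ∧ Continuous e₂ ∧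
    (∀ x, HasDerivAt f (f₁ x) x) ∧
    (∀ x, |f x| ≤ B ∧ |f₁ x| ≤ B ∧ |h x| ≤ B ∧ |y x| ≤ B ∧ |e₁ x| ≤ B ∧ |e₂ x| ≤ B) ∧
    (∀ x, xb ≤ x →
      f₁ x = 0 ∧ h x = 0 ∧ e₁ x = 0 ∧ e₂ x = E ∧ |f x + y x - 1| ≤ B * Real.exp (-(x - xb) / B)) ∧
    ∀ (u u₁ u₂ H : ℝ → ℂ) (Atop Abot x₁ x₂ : ℝ),
      x₁ ≤ x₂ → rPlus M a + δ₀ ≤ R x₁ → R x₂ ≤ Rb →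
      (∀ x, HasDerivAt u (u₁ x) x) → (∀ x, HasDerivAt u₁ (u₂ x) x) →
      (∀ x, u₂ x + ((ω ^ 2 - sepPotential M a ω m Λ (R x) : ℝ) : ℂ) * u x = H x) →
      Continuous H →
      Integrable (fun x ↦ ⟪H x, u₁ x⟫_ℝ) → Integrable (fun x ↦ ⟪H x, u x⟫_ℝ) →
      Integrable (fun x ↦ (H x * conj (u x)).im) →
      Tendsto (fun x ↦ u₁ x - Complex.I * ω * u x) atTop (𝓝 0) →
      Tendsto (fun x ↦ u₁ x + Complex.I * ((ω - horizonAngularVelocity M a * m : ℝ) : ℂ) * u x)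
        atBot (𝓝 0) →
      Tendsto (fun x ↦ ‖u x‖ ^ 2) atTop (𝓝 Atop) →
      Tendsto (fun x ↦ ‖u x‖ ^ 2) atBot (𝓝 Abot) →
      b * ∫ x in x₁..x₂, (‖u₁ x‖ ^ 2 + ((ω ^ 2 + Λ) * (1 - rtrap / R x) ^ 2 + 1) * ‖u x‖ ^ 2) ≤
        (∫ x, frozenSource ω (ω - horizonAngularVelocity M a * m) f f₁ h y e₁ e₂ u u₁ H x) +
          γ * Abot

/-- **Frozen Theorem 8.1 on a frequency range.** For every `0 ≤ a < M` (DRSR's reduction to `a ≥ 0`,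
their §4.2), every tortoise radius function, every bulk region `[r₊ + δ₀, R_b]` (`0 < δ₀ ≤ M`,
`R_b ≥ 8M`) and every far-field weight `E` above the threshold `B₀ = C κ̂^{-p}(M/δ₀)^p(R_b/M)^p`,
every admissible triple (`Kerr.IsAdmissibleTriple`, DRSR Def. 6.1.1) in the range `InRange a ω m Λ`
satisfies `FrozenEstimateAt` with the frequency-independent `B = frozenBound M a δ₀ R_b E C p`, the
left-hand constant `b = frozenLHS M B p ω Λ` and horizon coefficient `γ = B · boxIndicator M C ω Λ`.
[cite: DafermosRodnianskiShlapentokhrothman2014, Theorem 8.1 (frozen, κ̂-explicit form; not in the source)] -/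
def FrozenThm81On (M : ℝ) (InRange : ℝ → ℝ → ℤ → ℝ → Prop) (p C : ℝ) : Prop :=
  ∀ a : ℝ, 0 ≤ a → a < M → ∀ R : ℝ → ℝ, IsTortoiseRadius M a R →
    ∀ δ₀ : ℝ, 0 < δ₀ → δ₀ ≤ M → ∀ Rb : ℝ, 8 * M ≤ Rb →
      ∀ E : ℝ, frozenBound M a δ₀ Rb 0 C p ≤ E →
        ∀ (ω : ℝ) (m : ℤ) (Λ : ℝ), IsAdmissibleTriple a ω m Λ → InRange a ω m Λ →
          FrozenEstimateAt M a δ₀ Rb E (frozenBound M a δ₀ Rb E C p)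
            (frozenLHS M (frozenBound M a δ₀ Rb E C p) p ω Λ)
            (frozenBound M a δ₀ Rb E C p * boxIndicator M C ω Λ) R ω m Λ

/-- **C⁺ of the line: the frozen-partition, `κ̂`-explicit DRSR Theorem 8.1** on the whole range
`0 ≤ a < M`, all admissible triples. -/
def FrozenPhaseSpaceILED (M : ℝ) : Prop :=
  ∃ p C : ℝ, 0 ≤ p ∧ 0 < C ∧ FrozenThm81On M (fun _ _ _ _ ↦ True) p C

/-! ## The frozen partition -/

/-- BF-stable Carter sectors: `Λ ≥ (2 + θ)m²`. -/
def IsStableSector (θ : ℝ) (m : ℤ) (Λ : ℝ) : Prop := (2 + θ) * (m : ℝ) ^ 2 ≤ Λ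

/-- Throat (BF-violating) sectors: `Λ ≤ (2 − θ)m²` (with admissibility `Λ ≥ |m|(|m|+1)` this forces
`|m| ≥ 2`). -/
def IsThroatSector (θ : ℝ) (m : ℤ) (Λ : ℝ) : Prop := Λ ≤ (2 - θ) * (m : ℝ) ^ 2

/-- The BF-critical sliver `(2 − θ)m² < Λ < (2 + θ)m²`. -/
def IsSliverSector (θ : ℝ) (m : ℤ) (Λ : ℝ) : Prop :=
  (2 - θ) * (m : ℝ) ^ 2 < Λ ∧ Λ < (2 + θ) * (m : ℝ) ^ 2

/-! ## The stubs

Each stub's statement is the `Prop` `Sig.stub_<name>` (its SIGNATURE, a definition in this file) and the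
registered obligation is `theorem stub_<name> : Sig.stub_<name> := by sorry` below; the composition
`KappaExplicitWaveDecay_of` takes the seven signatures as hypotheses BY NAME (layer-invariant audit:
hypothesis heads = stub names). Obligation tags (`@[stub]`) are gate-stamped, not written here. -/

/-- **Stub A — the frozen stable barrier (card's first lemma `UniformStableSectorSeparation`; size M).**
DRSR Lemma 6.4.2 ("superradiant frequencies are not trapped") with its `α`-clause in the repaired
strip of `KerrFrequencyRanges.lean`, restricted to BF-stable sectors and then UNIFORM IN `a ∈ [0, M)`:
for every `M > 0` and `θ ∈ (0, 1]` there are `b > 0`, `α₀ > 0` such that for all `0 ≤ a < M`, all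
`0 ≤ α ≤ α₀` and every admissible triple in the strip `0 < mω ≤ ω₊m² + (α/M)|m|√Λ` with
`Λ ≥ (2+θ)m²`, some `r ∈ (r₊, 7M]` has `V₀(r) − ω² ≥ bΛ/M²`. Why plausibly true: at `a = M`,
`ω = ω₊m` the identity above gives `V₀ − ω² ≥ Λ s²(4θ − 4s − s²)/(4(2+θ)M²((1+s)²+1)²)` at
`r = M(1+s)`, i.e. `≥ cθ³Λ/M²` at `s = θ/2`; desk scan (evidence/stable_barrier_scan.out): the
infimum over `a ∈ [0,1)`, `m ≤ 10³`, superradiant `ω` of `sup_r (V₀−ω²)/Λ` is attained at `a → M`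
and equals `9.0e-4, 1.7e-4, 2e-5` for `θ = 0.5, 0.25, 0.1` (≈ `0.01 θ³`), while for throat sectors
`Λ = 1.25m²` it decays like `0.08 κ̂ → 0`. The tree has the fixed-`a` version
(`Kerr.exists_sepPotential₀_rmax_sub_sq_ge'`, constants degenerating as `a → M`). -/
def Sig.stub_frozenStableBarrier : Prop :=
  ∀ M : ℝ, 0 < M → ∀ θ : ℝ, 0 < θ → θ ≤ 1 →
    ∃ b α₀ : ℝ, 0 < b ∧ 0 < α₀ ∧
      ∀ a : ℝ, 0 ≤ a → a < M → ∀ α : ℝ, 0 ≤ α → α ≤ α₀ →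
        ∀ (ω : ℝ) (m : ℤ) (Λ : ℝ), IsAdmissibleTriple a ω m Λ →
          IsNearSuperradiant' M a (α / M) ω m Λ → IsStableSector θ m Λ →
            ∃ r : ℝ, rPlus M a < r ∧ r ≤ 7 * M ∧
              b * Λ / M ^ 2 ≤ sepPotential₀ M a ω m Λ r - ω ^ 2

/-- **Stub B — the stable-sector strip estimate (size L).** Granted Stub A, DRSR's large-superradiant
construction (Lemma 8.3.1 + Prop. 8.3.1: current `Q^f + Ϙ^h − E(χ₁Q^K + χ₂Q^T)`, `f` switching sign
at `r_max`, the bump `h` absorbing the `χ₁'`-switching error at the barrier top, `Q^K` at the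
horizon) runs on BF-stable sectors in the frozen strip for ALL `0 ≤ a < M` at high frequency
`Λ ≥ Λ₀`, with every constant polynomial in `κ̂⁻¹` (the only `a`-sensitive inputs being the horizon
slope `dV₀/dr(r₊) ≍ (r₊ − M)Λ ≍ κ̂^{1/2}Λ` of Lemma 6.4.1 and the tortoise length of the near-horizon
zone): for every `M, θ` there is `α₀ > 0` and, for every strip width `0 < α ≤ α₀`, thresholds
`Λ₀, p₀, C₀` with `FrozenThm81On M (strip(α) ∩ stable(θ) ∩ {Λ ≥ Λ₀}) p C` for all `p ≥ p₀`, `C ≥ C₀`. Why it might fail: the switching region must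
sit where `V − ω² ≥ bΛ/2`, at `r − r₊ = O(M)`, while `|u'|²`-control between it and `r₊ + δ₀` comes
only from `f' > 0` on a zone of tortoise length `≍ κ⁻¹ log`: losses must stay polynomial. -/
def Sig.stub_stableStripEstimate : Prop :=
  Sig.stub_frozenStableBarrier →
    ∀ M : ℝ, 0 < M → ∀ θ : ℝ, 0 < θ → θ ≤ 1 →
      ∃ α₀ : ℝ, 0 < α₀ ∧ ∀ α : ℝ, 0 < α → α ≤ α₀ →
        ∃ Λ₀ p₀ C₀ : ℝ, ∀ p C : ℝ, p₀ ≤ p → C₀ ≤ C →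
          FrozenThm81On M
            (fun a ω m Λ ↦ IsNearSuperradiant' M a (α / M) ω m Λ ∧ IsStableSector θ m Λ ∧ Λ₀ ≤ Λ) p C

/-- **Stub C — the throat-sector strip estimate (size XL; the HARDEST stub, the line's bet).** On
throat sectors `Λ ≤ (2−θ)m²` in the frozen strip, at high frequency, for ALL `0 ≤ a < M`, the
conclusion of Theorem 8.1 holds with `κ̂`-polynomial constants. Mechanism proposed by the card and
the planner's desk scan (evidence/throat_shape_scan.out, `a = 0.999`, `m = 100`, `Λ = 1.25m²`): in
the strip the full potential `V` has the SAME unimodal structure as in DRSR's `𝓖^♯` (one maximum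
`r_max`, `V' > 0` before, `V' < 0` after), but (i) at/below threshold the barrier is a MICRO-barrier,
`V(r_max) − ω² ≍ κ̂Λ` at `r_max − r₊ ≍ (r₊ − r₋)`, of tortoise width `≍ κ⁻¹` (the card's "cavity"),
so Prop. 8.3.1's bump needs amplitude only `A = O(E)` and `f' ≍ κ`; (ii) slightly above threshold
(`ϖ = 2κmξ̃`, `0 < ξ̃ ≲ 0.13`) `V(r_max) = ω²` exactly: the in-throat trapping of the near-NHEK face
(Lyapunov exponent `= κ`, triage T2), treated by the Prop. 8.6.1 template with `r_trap = r_max → r₊`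
(allowed: `|r_trap − r₊|⁻¹ ≤ B ≍ κ̂^{-1/2}`) and non-degeneracy `≍ κ²Λ`; (iii) further above, no
critical point: a `ϟ^y`-estimate with horizon margin `ϖ²` and bulk margin `θm²δ₀²/M⁴` on
`[r₊ + δ₀, R_b]`. Honest residual (triage, all lines): the two-parameter corner `h = |m|⁻¹ → 0`,
`κ → 0` where (i)–(iii) meet; a super-polynomial loss there for ONE fixed throat sector refutes the
crux itself (route kill criterion), a loss polynomial in `κ⁻¹` but not in `|m|` refutes only this
stub's `(1+M²ω²+Λ)^p` budget. Uses no `_false_without_` obstruction (no Disproof.lean exists). -/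
def Sig.stub_throatStripEstimate : Prop :=
  ∀ M : ℝ, 0 < M → ∀ θ : ℝ, 0 < θ → θ ≤ 1 →
    ∃ α₀ : ℝ, 0 < α₀ ∧ ∀ α : ℝ, 0 < α → α ≤ α₀ →
      ∃ Λ₀ p₀ C₀ : ℝ, ∀ p C : ℝ, p₀ ≤ p → C₀ ≤ C →
        FrozenThm81On M
          (fun a ω m Λ ↦ IsNearSuperradiant' M a (α / M) ω m Λ ∧ IsThroatSector θ m Λ ∧ Λ₀ ≤ Λ) p C

/-- **Stub S — the BF-critical sliver (size L/XL).** For SOME `θ ∈ (0, 1]` (the prover's choice: the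
sliver may be taken as thin as the argument needs) the sectors `(2−θ)m² < Λ < (2+θ)m²` in the frozen
strip at high frequency satisfy the frozen Theorem 8.1 with `κ̂`-polynomial constants. Here the
near-horizon critical point of `V` degenerates (`Λ = 2m²`, `a = M`, `ω = ω₊m`:
`V₀ − ω² = −(r−M)³m²(4M + (r−M))/(4M²(r²+M²)²)`, a cubic tangency; the face trapping radius
`x₀ → ∞` leaves the near zone): degenerate-trapping multipliers lose more powers of `(1+M²ω²+Λ)`
(allowed) — the claim is that they lose only powers. Triage note (hardy card, residual (ii)): these
are the near-critical sectors with Hardy margin `→ 0`; no Diophantine floor on spheroidal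
eigenvalues is assumed here because `Λ` is treated as a free real parameter. -/
def Sig.stub_sliverStripEstimate : Prop :=
  ∀ M : ℝ, 0 < M → ∃ θ : ℝ, 0 < θ ∧ θ ≤ 1 ∧
    ∃ α₀ : ℝ, 0 < α₀ ∧ ∀ α : ℝ, 0 < α → α ≤ α₀ →
      ∃ Λ₀ p₀ C₀ : ℝ, ∀ p C : ℝ, p₀ ≤ p → C₀ ≤ C →
        FrozenThm81On M
          (fun a ω m Λ ↦ IsNearSuperradiant' M a (α / M) ω m Λ ∧ IsSliverSector θ m Λ ∧ Λ₀ ≤ Λ) p C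

/-- **Stub D — everything DRSR already does `a`-uniformly (size L).** Off the frozen strip
(`¬ IsNearSuperradiant' M a (α/M)`, any `α > 0`: there `(ω − ω₊m)² ≥ (α/M)²Λ` or `mω ≤ 0`,
`KerrFrequencyRanges.min_mul_le_sq_sub_of_not_isNearSuperradiant'`) and on all bounded angular
frequencies `Λ < Λ₀` (any `Λ₀`), the frozen Theorem 8.1 holds with `κ̂`-polynomial constants: the
time-dominated range (`Kerr.timeDominated_estimate_kerr`, whose constant `3Mδ²/(16R_d⁴)` is already
`a`-free), the angular-dominated range `𝓖_𝄬` (`mω ≤ 0`, barrier `V₀(8M) ≥ 32Λ/(4225M²)`), the trapping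
range `𝓖_♮` (`Kerr.trapping_estimate_of_isFreqNatural'` re-run with the `a`-free horizon margin
`(α/M)²Λ`; the photon-sphere trapping of sub-extremal Kerr stays non-degenerate up to `a = M` away
from the threshold), and the bounded range `𝓖_♭` (DRSR §8.7: near-stationary multipliers incl. the
axisymmetric corner `m = 0`, `ω → 0`, `a → M` — red-shift weight `∝ κ⁻¹` —, and the non-stationary
bounded box with the horizon amplitude put on the right-hand side, `boxIndicator`). Why it might
fail: an `a → M` degeneration hiding in DRSR §8.7.1's "`a ≥ ã₀`" near-stationary construction for
`m = 0` that is worse than polynomial in `κ⁻¹`. -/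
def Sig.stub_offStripEstimate : Prop :=
  ∀ M : ℝ, 0 < M → ∀ α Λ₀ : ℝ, 0 < α →
    ∃ p₀ C₀ : ℝ, ∀ p C : ℝ, p₀ ≤ p → C₀ ≤ C →
      FrozenThm81On M (fun a ω m Λ ↦ ¬ IsNearSuperradiant' M a (α / M) ω m Λ ∨ Λ < Λ₀) p C

/-- **Stub W — quantitative mode stability on the bounded box, uniform in `a` (published, vendored,
UNPROVED in the tree; size XL as a proof, 0 as a citation).** Teixeira da Costa, CMP 378 (2020) =
arXiv:1910.02854, Prop. 6.3 restricted to `|a| < M`: the Wronskian of the normalised horizon/infinity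
radial solutions is bounded below on `{|ω| + |ω|⁻¹ + |m| + |λ| ≤ C}` by an explicit `G(C, M, s)⁻¹`
INDEPENDENT of `a` — including the double limit `ω → mω₊`, `a → M` (her Remark 6.4). This is exactly
what pays for the `boxIndicator` term (DRSR §9.7, where Shlapentokh-Rothman's `a`-inexplicit bound
was used). Referenced BY NAME (`Kerr.Costa2019_wronskianBound_subextremal`, cite item wi-26994 filed
for this crux) so that the gate tracks it as the line's unproved dependency; closing it = proving the
`s = 0` case of Prop. 6.3 over `TeukolskyRealAxisModeStability*.lean` (take-the-blocker), else the
line ends "closed modulo" it. -/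
def Sig.stub_boundedFrequencyWronskian : Prop :=
  Costa2019_wronskianBound_subextremal

/-- **Stub E — the physical-space transfer (size XL, infrastructure-heavy, known technique).** Granted
the `a`-uniform bounded-box Wronskian bound and the frozen phase-space ILED for every `M > 0`, the
crux follows: DRSR §4 (reduction to `a ≥ 0` by `φ ↦ −φ`; the red-shift multiplier `N` of Prop. 4.5.1
with constants tracked as powers of `κ⁻¹` on the layer `[r₊, r₊ + δ₀]`, `δ₀ ≍ κ̂M`; the large-`r`
current), §5 (Carter separation of the cut-off solution `ψ✂`, Plancherel — NOT yet in the tree),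
§9 (summation: the common far structure of `FrozenEstimateAt` resums the cut-off errors; the box term
via §9.7 and Stub W), §§10–11 (boundedness from ILED, the qualitative future-integrability continuity
argument, which needs no rate), then the Kerr–Schild slice bookkeeping already machine-checked for
the `a`-inexplicit facts (`drsr_wave_boundedness_kerr_of_DRSR`, `drsr_wave_integrated_decay_kerr_of_DRSR`:
finite speed of propagation, far `J^T` comparison, `T`-commutation) with its constants
(`R_far`, `R₀`, `s`) checked bounded on `|a| ≤ M`. The polynomial frequency weights `(1+M²ω²+Λ)^p`
become `j = j(p)` data derivatives (commutation with `T` and `Φ`, DRSR §10). Why it might fail only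
formally: the separation/Plancherel layer is large; mathematically every step is in print. -/
def Sig.stub_physicalSpaceTransfer : Prop :=
  Sig.stub_boundedFrequencyWronskian → (∀ M : ℝ, 0 < M → FrozenPhaseSpaceILED M) →
    Summit.FinalStateConjecture.FinalStateConjecture.Theses.PhaseMixingCapture.KappaExplicitWaveDecay

/-! ## Registered stubs -/

theorem stub_frozenStableBarrier : Sig.stub_frozenStableBarrier := by
  sorry

theorem stub_stableStripEstimate : Sig.stub_stableStripEstimate := by
  sorry

theorem stub_throatStripEstimate : Sig.stub_throatStripEstimate := by
  sorry

theorem stub_sliverStripEstimate : Sig.stub_sliverStripEstimate := by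
  sorry

theorem stub_offStripEstimate : Sig.stub_offStripEstimate := by
  sorry

theorem stub_boundedFrequencyWronskian : Sig.stub_boundedFrequencyWronskian := by
  sorry

theorem stub_physicalSpaceTransfer : Sig.stub_physicalSpaceTransfer := by
  sorry

/-! ## The composition: DRSR Lemma 8.1.1 for the frozen partition, then the transfer -/

/-- The four frozen ranges cover all admissible triples and their estimates share one constant
budget, so Stubs B, C, S, D assemble to the frozen phase-space ILED `C⁺`. -/
theorem frozenPhaseSpaceILED_of (hA : Sig.stub_frozenStableBarrier) (hB : Sig.stub_stableStripEstimate)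
    (hC : Sig.stub_throatStripEstimate) (hS : Sig.stub_sliverStripEstimate) (hD : Sig.stub_offStripEstimate)
    (M : ℝ) (hM : 0 < M) : FrozenPhaseSpaceILED M := by
  -- the sliver fixes `θ`; the three strip stubs fix the strip width `α`
  obtain ⟨θ, hθ, hθ1, αS, hαS, HS⟩ := hS M hM
  obtain ⟨αB, hαB, HB⟩ := hB hA M hM θ hθ hθ1
  obtain ⟨αC, hαC, HC⟩ := hC M hM θ hθ hθ1
  set α : ℝ := min αB (min αC αS) with hα_def
  have hα : 0 < α := lt_min hαB (lt_min hαC hαS)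
  have hαB' : α ≤ αB := min_le_left _ _
  have hαC' : α ≤ αC := (min_le_right _ _).trans (min_le_left _ _)
  have hαS' : α ≤ αS := (min_le_right _ _).trans (min_le_right _ _)
  obtain ⟨ΛB, pB, CB, HB⟩ := HB α hα hαB'
  obtain ⟨ΛC, pC, CC, HC⟩ := HC α hα hαC'
  obtain ⟨ΛS, pS, CS, HS⟩ := HS α hα hαS'
  -- the high-frequency threshold; below it and off the strip, Stub D
  set Λ₀ : ℝ := max ΛB (max ΛC ΛS) with hΛ₀_def
  obtain ⟨pD, CD, HD⟩ := hD M hM α Λ₀ hα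
  -- one common budget `(p, C)`
  set p : ℝ := max 0 (max (max pB pC) (max pS pD)) with hp_def
  set C : ℝ := max 1 (max (max CB CC) (max CS CD)) with hC_def
  have hp0 : 0 ≤ p := le_max_left _ _
  have hC0 : 0 < C := lt_of_lt_of_le one_pos (le_max_left _ _)
  have hpB : pB ≤ p := (le_max_left _ _).trans ((le_max_left _ _).trans (le_max_right _ _))
  have hpC : pC ≤ p := (le_max_right _ _).trans ((le_max_left _ _).trans (le_max_right _ _))
  have hpS : pS ≤ p := (le_max_left _ _).trans ((le_max_right _ _).trans (le_max_right _ _))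
  have hpD : pD ≤ p := (le_max_right _ _).trans ((le_max_right _ _).trans (le_max_right _ _))
  have hCB : CB ≤ C := (le_max_left _ _).trans ((le_max_left _ _).trans (le_max_right _ _))
  have hCC : CC ≤ C := (le_max_right _ _).trans ((le_max_left _ _).trans (le_max_right _ _))
  have hCS : CS ≤ C := (le_max_left _ _).trans ((le_max_right _ _).trans (le_max_right _ _))
  have hCD : CD ≤ C := (le_max_right _ _).trans ((le_max_right _ _).trans (le_max_right _ _))
  have HB' := HB p C hpB hCB
  have HC' := HC p C hpC hCC
  have HS' := HS p C hpS hCS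
  have HD' := HD p C hpD hCD
  refine ⟨p, C, hp0, hC0, ?_⟩
  -- DRSR Lemma 8.1.1 for the frozen partition: the four ranges cover all admissible triples
  intro a ha0 haM R hR δ₀ hδ₀ hδ₀M Rb hRb E hE ω m Λ hadm _
  by_cases hstrip : IsNearSuperradiant' M a (α / M) ω m Λ
  · by_cases hΛ : Λ₀ ≤ Λ
    · have hΛB : ΛB ≤ Λ := (le_max_left _ _).trans hΛ
      have hΛC : ΛC ≤ Λ := ((le_max_left _ _).trans (le_max_right _ _)).trans hΛ
      have hΛS : ΛS ≤ Λ := ((le_max_right _ _).trans (le_max_right _ _)).trans hΛ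
      by_cases hst : IsStableSector θ m Λ
      · exact HB' a ha0 haM R hR δ₀ hδ₀ hδ₀M Rb hRb E hE ω m Λ hadm ⟨hstrip, hst, hΛB⟩
      · by_cases hth : IsThroatSector θ m Λ
        · exact HC' a ha0 haM R hR δ₀ hδ₀ hδ₀M Rb hRb E hE ω m Λ hadm ⟨hstrip, hth, hΛC⟩
        · have hsl : IsSliverSector θ m Λ := ⟨lt_of_not_ge hth, lt_of_not_ge hst⟩
          exact HS' a ha0 haM R hR δ₀ hδ₀ hδ₀M Rb hRb E hE ω m Λ hadm ⟨hstrip, hsl, hΛS⟩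
    · exact HD' a ha0 haM R hR δ₀ hδ₀ hδ₀M Rb hRb E hE ω m Λ hadm (Or.inr (lt_of_not_ge hΛ))
  · exact HD' a ha0 haM R hR δ₀ hδ₀ hδ₀M Rb hRb E hE ω m Λ hadm (Or.inl hstrip)

/-- **The line.** Stubs A, B, C, S, D, W, E imply the crux `KappaExplicitWaveDecay` BY NAME. -/
theorem KappaExplicitWaveDecay_of :
    Sig.stub_frozenStableBarrier → Sig.stub_stableStripEstimate → Sig.stub_throatStripEstimate →
      Sig.stub_sliverStripEstimate → Sig.stub_offStripEstimate → Sig.stub_boundedFrequencyWronskian →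
        Sig.stub_physicalSpaceTransfer →
          Summit.FinalStateConjecture.FinalStateConjecture.Theses.PhaseMixingCapture.KappaExplicitWaveDecay :=
  fun hA hB hC hS hD hW hE ↦ hE hW (frozenPhaseSpaceILED_of hA hB hC hS hD)

/-- The skeleton instantiated: the crux modulo the seven registered stubs. -/
theorem KappaExplicitWaveDecay_skeleton :
    Summit.FinalStateConjecture.FinalStateConjecture.Theses.PhaseMixingCapture.KappaExplicitWaveDecay :=
  KappaExplicitWaveDecay_of stub_frozenStableBarrier stub_stableStripEstimate stub_throatStripEstimate
    stub_sliverStripEstimate stub_offStripEstimate stub_boundedFrequencyWronskian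
    stub_physicalSpaceTransfer

end Summit.FinalStateConjecture.FinalStateConjecture.Cruxes.KappaExplicitWaveDecay.BfSignFrozenRanges

end
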